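import Mathlib.Algebra.Field.Basic
import Mathlib.GroupTheory.OrderOfElement
import Mathlib.Topology.Algebra.ContinuousMonoidHom
import Mathlib.Logic.Relation
import Mathlib.Logic.Function.Iterate
import HarnessLib

/-!
# [J-III] §8.3.4, §8.3.6, §8.4: the `L^*`-action on pictures, «Rosetta Stone» Fragment 2 (coricity), and Mochizuki's
# diagram of coverings (Lemma 8.4.1)

K. Joshi, *Construction of Arithmetic Teichmüller Spaces III: A 'Rosetta Stone' and a proof of Mochizuki's
Corollary 3.12*, arXiv:2401.13508v4 («Preliminary version for comments», UNREFEREED; bib `Joshi2024ATS3`, claim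
status `disputed`, D-0012), §8.3.4 (p.77 l.23–32), §8.3.6 (p.80 l.1–30), §8.4 with Lemma 8.4.1 (p.80 l.31–p.81 l.7);
render `HOME/lit/renders/Joshi-arxiv-2401.13508/`. Cell abc-iut, block E (rung LADDER-ABC:A2.E), seat abc-iut-E-t16,
slot T-16; companion of `RosettaFragment1.lean` (§8.1–§8.3.5, the étale-like / Frobenius-like data); inventory
`HOME/plan/E/t16/INVENTORY.tsv`. TYPED ≠ PROVED ≠ ENDORSED; sentences Joshi ASSERTS are `Prop`-valued `def`s tagged
`@[claim "Joshi2024ATS3" "disputed"]`, never asserted; what follows from the typed signature is PROVED. No side is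
taken on [IUTchIII] Cor. 3.12, on Joshi's claims, or on Mochizuki's report on them. This file is deliberately
self-contained (Mathlib + HarnessLib): its three items are statements about ABSTRACT actions / maps / subgroup
diagrams, and the dictionary to OUR side is recorded by fully-qualified name in the docstrings.

* §8.3.4 «`L^*`-action on (étale, Frobenius)-pictures» via `L^* ↷ 𝒴_L` [Joshi 2023a Thm. 4.2.3]; «principal property»
  [IUTchIII Rmk. 1.2.3 (ii); Joshi 2023a Thm. 4.4.1]: `α` acts trivially ⇒ `α` is a root of unity —
  `LStarTrivialActorIsTorsion` (claim) over an abstract `MulAction Lˣ Y`; PROVED reformulation `iff_ker` (the kernel of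
  the action is a torsion group). Tree side: `Literature.IUT.LogThetaLattice.unit_at_all_places_iff_torsion`
  (= Mathlib `NumberField.Units.mem_torsion`). [Joshi 2023a] (arithmeticoids, `𝒴_L`) is not among the block's five
  typed sources, hence the abstraction.
* §8.3.6 ROSETTA STONE FRAGMENT 2 (table p.80): «mono-analytization at `v`» ↔ «working with a specific (local)
  holomorphoid `hol(X/L_v)_{y_v}`»; «coric objects, structures at `v`» ↔ «`φ_v`-invariant objects, structures»;
  «mono-analytic prime-strip `𝓕^?_{Mochizuki,v}`» ↔ «`𝓕^?_{Joshi,v}(hol(X/L_v)_{y_v})`, §8.6» (slot T-17,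
  `Joshi/RosettaFragment3.lean`); «mono-analytic log-shell at `v`» ↔ «the log-shell given by a specific (local)
  holomorphoid» (§9.2–9.3, slot T-19); «global coricity» ↔ «working with `𝒴_{L′}/φ^ℤ = 𝒳_{L′}` or `𝒴_{L′}/L′^*`».
  The rows typable as mathematics here: `IsCoric φ f` (`φ`-invariance), `IsCoricFor M f` (invariance under a monoid,
  `M = φ^ℕ` resp. `L′^*`), PROVED `isCoric_iff_factorsThrough` (coric ⇔ lives on the `φ`-orbit quotient) and
  `isCoric_iff_forall_iterate`. Tree side of «coric»: [IUTchI] Rmk. 3.9.1 «`𝒟⊢_v` constitutes a core»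
  (`Literature.IUT.HodgeTheaters.EtalePictureCore.etaleObservable_isCore`), `Literature.IUT.HodgeTheaters.FPrimeStripsCoric`;
  of «mono-analytic log-shell»: `Literature.AnabelianGeometry.AbsoluteAnabelian.MonoAnalyticNonarch` ([AbsTopIII] §5).
  Delta recorded for the referee lane: «mono-analytic ≙ a SPECIFIC holomorphoid» has no typed counterpart on our side
  beyond the core `𝒟⊢_v`.
* §8.4 / Lemma 8.4.1: «a certain diagram of coverings constructed using `arith(L)_y` … [Mochizuki, 2009], [Mochizuki,
  2021a, §1 and §2]»; (1) «a construction of various finite étale and tempered coverings of `X/L_v` … [IUTchI §1 p.42;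
  Def. 3.1 (d) p.68; Def. 3.1 (e) p.69]»; (2) «the isomorphism class of the diagram of topological groups, obtained by
  applying the étale (resp. tempered fundamental group) functor … is independent of the choice of the arithmeticoid».
  Typed: `CoveringDiagram ι Γ` (the `π₁`-image: `ι`-indexed open subgroups of `Γ = Π^temp`), `DiagramIso` (PROVED an
  equivalence relation — `refl`, `symm`, `trans` — so «isomorphism class» is well defined), claim `Lemma841`, and the
  PROVED shape of the printed proof `lemma841_of_iso_reference` («determined from the … fundamental group»: any family
  isomorphic to one reference diagram satisfies (2)). Tree side (closure-free, defined from the group alone, so (2) is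
  automatic there): `Literature.IUT.HodgeTheaters.PuncturedEllipticData` ([IUTchI] §1: `piXarrow`, `piCarrow`),
  `ThetaGeometry` (Def. 3.1 (b)(d)(f)), `CharacteristicNatureOfCoverings` (Cor. 1.2).
Standard axioms only; sorry-free; nothing of Joshi's text is asserted.
-/

namespace Summit.ABC.IUTFork.Joshi.Rosetta

/-! ## 1. §8.3.4: the `L^*`-action on (étale, Frobenius)-pictures -/

section LStar

/-- **§8.3.4, the «principal property» of the `L^*`-action** (p.77 l.23–32: «There is natural action of `L^*` on the set
of pairs consisting of (étale, Frobenius)-pictures … Mochizuki asserts the principal property of this action [Mochizuki,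
2021c, Remark 1.2.3 (ii)], namely that if `α ∈ L^*` acts trivially, then `α` is a root of unity. In [Joshi, 2023a,
Theorem 4.2.3], I demonstrate the existence of the natural multiplicative action of `L^* ↷ 𝒴_L` … The fundamental
property … is proved in [Joshi, 2023a, Theorem 4.4.1]»), typed over an ABSTRACT action of `L^×` on the space `Y = 𝒴_L`
of arithmeticoids: an element acting trivially has finite order. Tree side of Rmk. 1.2.3 (ii):
`Literature.IUT.LogThetaLattice.unit_at_all_places_iff_torsion`. HYPOTHESIS (claim), never asserted.
[claim: Joshi2024ATS3, status: disputed] -/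
@[claim "Joshi2024ATS3" "disputed"]
def LStarTrivialActorIsTorsion (L : Type) [Field L] (Y : Type) [MulAction Lˣ Y] : Prop :=
  ∀ α : Lˣ, (∀ y : Y, α • y = y) → IsOfFinOrder α

/-- PROVED (what the typed signature gives for free): the «principal property» says exactly that the kernel of the
action `L^× → Perm(𝒴_L)` is a torsion group. -/
theorem LStarTrivialActorIsTorsion.iff_ker (L : Type) [Field L] (Y : Type) [MulAction Lˣ Y] :
    LStarTrivialActorIsTorsion L Y ↔ ∀ α ∈ (MulAction.toPermHom Lˣ Y).ker, IsOfFinOrder α := by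
  refine ⟨fun h α hα => h α fun y => ?_, fun h α hα => h α ?_⟩
  · have := congrArg (fun σ : Equiv.Perm Y => σ y) (MonoidHom.mem_ker.mp hα)
    simpa using this
  · refine MonoidHom.mem_ker.mpr (Equiv.ext fun y => ?_)
    simpa using hα y

/-- The induced action on «the set of pairs consisting of (étale, Frobenius)-pictures» (p.77 l.23–24, l.29–31: «`L^* ↷
𝒴_L` provides the required action on the sets of such pairs (arising, as above, from arithmeticoids in `𝒴_L`)»): a
picture-valued construction `pic` on `𝒴_L` is moved by precomposition. [claim: Joshi2024ATS3, status: disputed] -/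
def picturesTranslate {L : Type} [Field L] {Y : Type} [MulAction Lˣ Y] {β : Type} (pic : Y → β) (α : Lˣ) :
    Y → β :=
  fun y => pic (α • y)

/-- PROVED: translating pictures is an action — `1` acts trivially and products compose (so «the set of pairs …
indexed by arithmeticoids» inherits the `L^*`-action, as §8.3.4 says). -/
theorem picturesTranslate_one_mul {L : Type} [Field L] {Y : Type} [MulAction Lˣ Y] {β : Type} (pic : Y → β)
    (α α' : Lˣ) : picturesTranslate pic (1 : Lˣ) = pic ∧
      picturesTranslate pic (α * α') = picturesTranslate (picturesTranslate pic α) α' := by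
  refine ⟨funext fun y => ?_, funext fun y => ?_⟩
  · simp [picturesTranslate]
  · simp [picturesTranslate, mul_smul]

end LStar

/-! ## 2. Fragment 2 (§8.3.6): «coric = `φ_v`-invariant», «global coricity = working modulo `φ^ℤ` or `L′^*`» -/

section Coric

variable {Y : Type} {α : Type}

/-- **Fragment 2, row 2** (p.80 l.10–11: «coric objects, structures at `v`» ↔ «working with `φ_v`-invariant objects,
structures»): a construction `f` on the space `Y` (of arithmeticoids / points of `𝒴_{L′}`) with Frobenius `φ` is
CORIC when it is `φ`-invariant. Tree side: [IUTchI] Rmk. 3.9.1 «`𝒟⊢_v` constitutes a core»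
(`Literature.IUT.HodgeTheaters.EtalePictureCore.etaleObservable_isCore`). [claim: Joshi2024ATS3, status: disputed] -/
@[claim "Joshi2024ATS3" "disputed"]
def IsCoric (φ : Y → Y) (f : Y → α) : Prop := ∀ y, f (φ y) = f y

/-- **Fragment 2, row 5** (p.80 l.25–28: «global coricity» ↔ «working with `𝒴_{L′}/φ^ℤ = 𝒳_{L′}` or its variants such
as `𝒴_{L′}/L′^*`»): coric for every element of a monoid `M` acting on `Y` (`M =` powers of `φ`, resp. `L′^*`).
[claim: Joshi2024ATS3, status: disputed] -/
@[claim "Joshi2024ATS3" "disputed"]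
def IsCoricFor (M : Type) [Monoid M] [MulAction M Y] (f : Y → α) : Prop := ∀ (m : M) (y : Y), f (m • y) = f y

/-- The `φ`-orbit relation on `Y` (equivalence closure of `y ~ φ y`), whose quotient is «`𝒴_{L′}/φ^ℤ = 𝒳_{L′}`»
(p.80 l.26). [claim: Joshi2024ATS3, status: disputed] -/
def frobOrbitSetoid (φ : Y → Y) : Setoid Y := Relation.EqvGen.setoid fun y y' => y' = φ y

/-- PROVED — the dictionary row «coric ↔ `φ`-invariant ↔ lives on `𝒴/φ^ℤ`»: a construction is `φ`-invariant iff it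
factors through the quotient of `Y` by the `φ`-orbit relation. -/
theorem isCoric_iff_factorsThrough (φ : Y → Y) (f : Y → α) :
    IsCoric φ f ↔ ∃ g : Quotient (frobOrbitSetoid φ) → α, f = g ∘ Quotient.mk (frobOrbitSetoid φ) := by
  constructor
  · intro h
    have hresp : ∀ a b : Y, (frobOrbitSetoid φ) a b → f a = f b := by
      intro a b hab
      induction hab with
      | rel x y hxy => rw [hxy, h x]
      | refl x => rfl
      | symm x y _ ih => exact ih.symm
      | trans x y z _ _ ih₁ ih₂ => exact ih₁.trans ih₂
    exact ⟨Quotient.lift f hresp, funext fun y => rfl⟩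
  · rintro ⟨g, rfl⟩ y
    show g _ = g _
    congr 1
    exact Quotient.sound (Relation.EqvGen.symm _ _ (Relation.EqvGen.rel _ _ rfl))

/-- PROVED: coric for the generator `φ` is the same as coric for all its iterates — «`φ_v`-invariant» (row 2) and
«modulo `φ^ℤ`» (row 5, for the monoid of powers) agree. -/
theorem isCoric_iff_forall_iterate (φ : Y → Y) (f : Y → α) :
    IsCoric φ f ↔ ∀ (n : ℕ) (y : Y), f (φ^[n] y) = f y := by
  refine ⟨fun h n => ?_, fun h y => by simpa using h 1 y⟩
  induction n with
  | zero => intro y; rfl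
  | succ n ih => intro y; rw [Function.iterate_succ_apply', h, ih]

/-- PROVED: a construction coric for a monoid action is coric for the map «act by `m`», for every `m` (rows 2 and 5 of
Fragment 2 are the same notion seen element-wise). -/
theorem IsCoricFor.isCoric_smul {M : Type} [Monoid M] [MulAction M Y] {f : Y → α} (h : IsCoricFor M f) (m : M) :
    IsCoric (fun y : Y => m • y) f :=
  fun y => h m y

end Coric

/-! ## 3. §8.4: Mochizuki's diagram of coverings and Lemma 8.4.1 -/

section Coverings

/-- **§8.4, the `π₁`-image of Mochizuki's diagram of coverings** (p.80 l.31–35: «one has a certain diagram of coverings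
constructed using `arith(L)_y` (which will not be recalled here) … detailed in [Mochizuki, 2009] and also in [Mochizuki,
2021a, §1 and §2]»; Lemma 8.4.1 (1) «various finite étale and tempered coverings of `X/L_v` … [Mochizuki, 2021a, §1,
Page 42], [Definition 3.1(d), Page 68], [Definition 3.1(e), Page 69]»): applying the (tempered) fundamental group
functor to a diagram of coverings of `X/L_v` indexed by `ι` yields open subgroups of `Γ = Π^temp_{X/L_v;K_v}`. Tree
side (closure-free, inside one group): `Literature.IUT.HodgeTheaters.PuncturedEllipticData` ([IUTchI] §1: `Π_{X̲→}`,
`Π_{C̲→}`), `ThetaGeometry` ([IUTchI] Def. 3.1 (b)(d)(f)). [claim: Joshi2024ATS3, status: disputed] -/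
structure CoveringDiagram (ι : Type) (Γ : Type) [Group Γ] [TopologicalSpace Γ] where
  /-- the subgroup `π₁(cover i) ⊆ Γ = Π^temp` -/
  sub : ι → Subgroup Γ
  /-- finite étale / tempered coverings give OPEN subgroups -/
  isOpen_sub : ∀ i, IsOpen (sub i : Set Γ)

variable {ι : Type} {Γ₁ Γ₂ Γ₃ : Type} [Group Γ₁] [TopologicalSpace Γ₁] [Group Γ₂] [TopologicalSpace Γ₂]
  [Group Γ₃] [TopologicalSpace Γ₃]

/-- «The isomorphism class of the diagram of topological groups» (Lemma 8.4.1 (2), p.80 l.43–46): two `ι`-indexed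
diagrams inside `Γ₁`, `Γ₂` are isomorphic when an isomorphism of topological groups carries each member of the first
onto the corresponding member of the second. [claim: Joshi2024ATS3, status: disputed] -/
def DiagramIso (D₁ : CoveringDiagram ι Γ₁) (D₂ : CoveringDiagram ι Γ₂) : Prop :=
  ∃ e : Γ₁ ≃ₜ* Γ₂, ∀ i, (D₁.sub i).map e.toMonoidHom = D₂.sub i

/-- PROVED: `DiagramIso` is reflexive. -/
theorem DiagramIso.refl (D : CoveringDiagram ι Γ₁) : DiagramIso D D := by
  refine ⟨ContinuousMulEquiv.refl Γ₁, fun i => ?_⟩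
  ext x
  constructor
  · rintro ⟨y, hy, rfl⟩
    exact hy
  · intro hx
    exact ⟨x, hx, rfl⟩

/-- PROVED: `DiagramIso` is symmetric (transport back along the inverse isomorphism). -/
theorem DiagramIso.symm {D₁ : CoveringDiagram ι Γ₁} {D₂ : CoveringDiagram ι Γ₂} (h : DiagramIso D₁ D₂) :
    DiagramIso D₂ D₁ := by
  obtain ⟨e, he⟩ := h
  refine ⟨e.symm, fun i => ?_⟩
  rw [← he i, Subgroup.map_map]
  have : e.symm.toMonoidHom.comp e.toMonoidHom = MonoidHom.id Γ₁ := MonoidHom.ext fun x => e.symm_apply_apply x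
  rw [this, Subgroup.map_id]

/-- PROVED: `DiagramIso` is transitive; with `refl`/`symm` this makes «the isomorphism class of the diagram»
(Lemma 8.4.1 (2)) well defined. -/
theorem DiagramIso.trans {D₁ : CoveringDiagram ι Γ₁} {D₂ : CoveringDiagram ι Γ₂} {D₃ : CoveringDiagram ι Γ₃}
    (h₁₂ : DiagramIso D₁ D₂) (h₂₃ : DiagramIso D₂ D₃) : DiagramIso D₁ D₃ := by
  obtain ⟨e, he⟩ := h₁₂
  obtain ⟨f, hf⟩ := h₂₃
  refine ⟨e.trans f, fun i => ?_⟩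
  rw [← hf i, ← he i, Subgroup.map_map]
  rfl

/-- **Lemma 8.4.1** (p.80 l.36–46: «Let `hol(X/L)_y` … be a holomorphoid of `X/L` and suppose that §2.4, §3.1, §3.3
hold. Then (1) one has a construction of various finite étale and tempered coverings of `X/L_v` (for each
`v ∈ V^non_L`) … and moreover, (2) the isomorphism class of the diagram of topological groups, obtained by applying the
étale (resp. tempered fundamental group) functor to this diagram of coverings obtained using `hol(X/L)_y`, is
independent of the choice of the arithmeticoid `arith(L)_y` provided by the holomorphoid»; proof p.81 l.1–7 «quite
geometric … determined from the étale fundamental group (resp. the tempered fundamental group) of `X/L` (resp. `X/L_v`)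
and its stack quotients by `{±1}`»), typed for the diagrams `cov y` attached to the holomorphoid data `y : J` over one
`L_v` (groups `Γof y`): all lie in one `DiagramIso` class. On the tree side the diagram is DEFINED group-theoretically
([IUTchI] Cor. 1.2, `Literature.IUT.HodgeTheaters.PuncturedEllipticData.CharacteristicNatureOfCoverings`), which is the
printed reason. HYPOTHESIS (claim), never asserted. [claim: Joshi2024ATS3, status: disputed] -/
@[claim "Joshi2024ATS3" "disputed"]
def Lemma841 {J : Type} (Γof : J → Type) [∀ y, Group (Γof y)] [∀ y, TopologicalSpace (Γof y)]
    (cov : ∀ y, CoveringDiagram ι (Γof y)) : Prop :=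
  ∀ y₁ y₂ : J, DiagramIso (cov y₁) (cov y₂)

/-- PROVED: Lemma 8.4.1 (2) holds for any family of diagrams all isomorphic to one reference diagram (e.g. the tree's
closure-free diagram built from `Π` alone) — the shape of the printed proof «determined from the … fundamental group». -/
theorem lemma841_of_iso_reference {J : Type} (Γof : J → Type) [∀ y, Group (Γof y)]
    [∀ y, TopologicalSpace (Γof y)] (cov : ∀ y, CoveringDiagram ι (Γof y)) (D₀ : CoveringDiagram ι Γ₁)
    (h : ∀ y, DiagramIso (cov y) D₀) : Lemma841 Γof cov :=
  fun y₁ y₂ => (h y₁).trans (h y₂).symm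

/-- PROVED: conversely, Lemma 8.4.1 (2) for a nonempty family says every member is isomorphic to the diagram of any
chosen member — «the isomorphism class» is that of one reference diagram. -/
theorem Lemma841.iso_of_mem {J : Type} {Γof : J → Type} [∀ y, Group (Γof y)] [∀ y, TopologicalSpace (Γof y)]
    {cov : ∀ y, CoveringDiagram ι (Γof y)} (h : Lemma841 Γof cov) (y₀ y : J) : DiagramIso (cov y) (cov y₀) :=
  h y y₀

end Coverings

end Summit.ABC.IUTFork.Joshi.Rosetta
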